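import Summits.MatrixMultiplication.OmegaCensus.STPPSmallPatternWitnesses
import Mathlib.GroupTheory.Exponent
import Mathlib.GroupTheory.Perm.Cycle.Type
import Mathlib.Data.Nat.Squarefree
import Mathlib.Tactic.NormNum.Prime

/-!
# ω-census, small STPP patterns: the SQUAREFREE LAW DROP — an order law at `N + 1` plus the cyclic host `ℤ/N` give the law at `N` when `N` is squarefree

Cell `pub-omega`, ω construction census, seat pub-omega ENG2 (gen 39), 2026-08-30.  HONEST FRAMING (verbatim): lottery ticket; floor = certified
bounds/negative ranges.  Census STRUCTURE TOOL (row B5 / conjecture C10, all columns); nothing here bears on `ω`.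

The device behind tonight's drops `58 → 57` (`k = 9`), `96 → 95` (`k = 12`), `110 → 109` (`k = 13`), made generic so the next one is a one-liner:

* `exponent_eq_card_of_squarefree` / `exists_addOrderOf_eq_card_of_squarefree`: a finite abelian group of SQUAREFREE order `n` has exponent `n`, hence an
  element of order `n` (so it is cyclic) — elementary: the exponent `e` divides `n`; if `e < n`, a prime `p` divides `n / e`, Cauchy gives an element of order
  `p`, so `p ∣ e` too and `p² ∣ n`, contradicting squarefreeness.  (No structure theorem.)
* `exists_isSTPP_of_card_ge_of_squarefree`: for any pattern `(a,b,c)^k`, an all-abelian order law from `N + 1` together with a transport lemma «an element of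
  additive order `≥ N` ⇒ host» (the tree's `…_of_addOrderOf_ge<N>` form, i.e. the cyclic column is gap-free from `N`) yields the law from `N` whenever `N` is
  squarefree.  Usage: `k = 12` at `94 = 2·47` the moment `ℤ/94` hosts `(2,1,1)¹²`; NOT applicable at `56 = 2³·7`, `68 = 2²·17`, `81 = 3⁴`, `108 = 2²·3³`
  (there the non-cyclic types of that order must be typed separately).

References: H. Cohn, R. Kleinberg, B. Szegedy, C. Umans, FOCS 2005 (arXiv:math/0511460), Def. 5.1 (pattern bookkeeping only).
-/

open Literature.Computability.AlgebraicComplexity Finset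

universe u

namespace Summit.MatrixMultiplication.OmegaCensus

/-- **A finite abelian group of squarefree order has exponent equal to its order.** [folklore] -/
theorem exponent_eq_card_of_squarefree {G : Type*} [AddCommGroup G] [Finite G] (hsq : Squarefree (Nat.card G)) :
    AddMonoid.exponent G = Nat.card G := by
  obtain ⟨m, hm⟩ := AddGroup.exponent_dvd_nat_card (G := G)
  have hn0 : Nat.card G ≠ 0 := Nat.card_pos.ne'
  by_contra hne
  have hm1 : m ≠ 1 := by
    intro h1; rw [h1, mul_one] at hm; exact hne hm.symm
  have hp : (Nat.minFac m).Prime := Nat.minFac_prime hm1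
  haveI : Fact (Nat.minFac m).Prime := ⟨hp⟩
  have hpm : Nat.minFac m ∣ m := Nat.minFac_dvd m
  have hpn : Nat.minFac m ∣ Nat.card G := by rw [hm]; exact dvd_mul_of_dvd_right hpm _
  obtain ⟨g, hg⟩ := exists_prime_addOrderOf_dvd_card' (G := G) (Nat.minFac m) hpn
  have hpe : Nat.minFac m ∣ AddMonoid.exponent G := hg ▸ AddMonoid.addOrder_dvd_exponent g
  have hsq' : Nat.minFac m * Nat.minFac m ∣ Nat.card G := by rw [hm]; exact mul_dvd_mul hpe hpm
  have hu := hsq (Nat.minFac m) hsq'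
  rw [Nat.isUnit_iff] at hu
  exact hp.one_lt.ne' hu

/-- **A finite abelian group of squarefree order `n` has an element of additive order `n`** (hence is cyclic). [folklore] -/
theorem exists_addOrderOf_eq_card_of_squarefree {G : Type*} [AddCommGroup G] [Finite G] (hsq : Squarefree (Nat.card G)) :
    ∃ g : G, addOrderOf g = Nat.card G := by
  obtain ⟨g, hg⟩ := AddMonoid.exists_addOrderOf_eq_exponent (G := G) AddMonoid.ExponentExists.of_finite
  exact ⟨g, hg.trans (exponent_eq_card_of_squarefree hsq)⟩

/-- **THE SQUAREFREE LAW DROP.** For any size pattern `(a,b,c)^k`: an all-abelian order law from `N + 1` and a transport lemma «an element of additive order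
`≥ N` gives a family» (the cyclic column gap-free from `N`) yield the order law from `N`, provided `N` is squarefree (the only abelian group of order `N` is
then cyclic — via `exists_addOrderOf_eq_card_of_squarefree`). [cite: CohnKleinbergSzegedyUmans2005, Def. 5.1] -/
theorem exists_isSTPP_of_card_ge_of_squarefree {k a b c N : ℕ}
    (hlaw : ∀ (Q : Type u) [AddCommGroup Q] [Finite Q], N + 1 ≤ Nat.card Q →
      ∃ A B C : Fin k → Finset Q, IsSTPP A B C ∧ ∀ i, (A i).card = a ∧ (B i).card = b ∧ (C i).card = c)
    (hray : ∀ (Q : Type u) [AddCommGroup Q] (g : Q), N ≤ addOrderOf g →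
      ∃ A B C : Fin k → Finset Q, IsSTPP A B C ∧ ∀ i, (A i).card = a ∧ (B i).card = b ∧ (C i).card = c)
    (hsq : Squarefree N) {G : Type u} [AddCommGroup G] [Finite G] (hG : N ≤ Nat.card G) :
    ∃ A B C : Fin k → Finset G, IsSTPP A B C ∧ ∀ i, (A i).card = a ∧ (B i).card = b ∧ (C i).card = c := by
  by_cases h : N + 1 ≤ Nat.card G
  · exact hlaw G h
  · have hc : Nat.card G = N := by omega
    obtain ⟨g, hg⟩ := exists_addOrderOf_eq_card_of_squarefree (G := G) (hc ▸ hsq)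
    exact hray G g (by rw [hg, hc])

/-- Squarefreeness of a concrete threshold, the way a law-drop file certifies it (`Nat.squarefree_mul_iff` + primality by `norm_num`; the
`DecidablePred` instance does not reduce under `decide`): tonight's three drops. [folklore] -/
theorem squarefree_57_95_109 : Squarefree (57 : ℕ) ∧ Squarefree (95 : ℕ) ∧ Squarefree (109 : ℕ) := by
  refine ⟨?_, ?_, ?_⟩
  · rw [show (57 : ℕ) = 3 * 19 from rfl, Nat.squarefree_mul_iff]
    exact ⟨by norm_num, Irreducible.squarefree Nat.prime_three, Irreducible.squarefree (by norm_num : Nat.Prime 19)⟩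
  · rw [show (95 : ℕ) = 5 * 19 from rfl, Nat.squarefree_mul_iff]
    exact ⟨by norm_num, Irreducible.squarefree (by norm_num : Nat.Prime 5), Irreducible.squarefree (by norm_num : Nat.Prime 19)⟩
  · exact Irreducible.squarefree (by norm_num : Nat.Prime 109)

end Summit.MatrixMultiplication.OmegaCensus
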